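/-
Copyright (c) 2026 the pub-hodgecm-mathlib formalisation cell (harness21).  Prover seat hodgecm-mathlib-K2E1-p13 (g5), Track B ∕ K2-LIT, h413 = `stmt-HodgeConjecture-24833`,
R90-TF section S8 «ContSpec-n½», S8 dealer R90-CS-plan (g3) S8-R192 (∞-2) «GENERAL BLOCKS: THE SHIFTED WITNESS», census `R90/S8/CENSUS-ArchSectionShiftedU3.K2E1-p13-g5.md`
51c4844f2a91ac38 — DEFINITIONS (file (α)): the `V₊`-functional `𝓈(a) := x₂ + x₀` of the last row, the degree-`0` RATIONAL TWIST `∏_w ((x₀+x₂)_w ∕ ℓ_w)^{p_w}·(conj ∕ conj)^{q_w}` and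
the SHIFTED ARCHIMEDEAN SECTION `archSectionShifted χ₁ χ₂ p q := twist · archSectionE χ₁ χ₂` (★ K2E1-p11 `archSectionE`, the section of record, is the case `p = q = 0`).
-/
import Summits.HodgeConjecture.HodgeConjecture.Theorems.R90S8ChiSectionPairArchSectionU3Defs   -- ★ K2E1-p11 (g4): `archLastRow`, `archLastRowL` (`ℓ = x₂ − x₀`), `archSectionE`
import HarnessLib

/-!
# S8 (∞-2) — `R90S8ChiSectionPairArchSectionShiftedU3Defs`: the SHIFTED archimedean last-row section — definitions
# `archLastRowS a = x₂ + x₀`, `archShiftFactor p q a = ∏_{w∣∞} ((x₀+x₂)_w ∕ ℓ(a)_w)^{p_w} · (conj (x₀+x₂)_w ∕ conj ℓ(a)_w)^{q_w}`, **`archSectionShifted χ₁ χ₂ p q a = archShiftFactor p q a · archSectionE χ₁ χ₂ a`**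

Track B ∕ K2-LIT, crux h413 = `stmt-HodgeConjecture-24833`, route of record `HCCMUnconditional`; cell `hodgecm-mathlib`, R90-TF programme, section S8 «ContSpec-n½», road R2-χ₃, (V)(iii) row
`hA32 : A(3∕2) ≠ 0` for GENERAL blocks (S8-R192 (∞-2)).  DEFINITIONS FILE (`--kind definition --supports stmt-HodgeConjecture-24833 --as helper`): three `def`s + `rfl` read-backs; no
`instance`, no `notation`, no named-fact hypothesis, no `sorry`.  CLOSES NO SOCKET; pays no letter: it FIXES THE BYTES of the shifted section whose structure theorems (Borel
equivariance inherited from ★ `archSectionE_archPart_mul`, continuity, `Φ(1) = 1`, big-cell law) are file (β) `R90S8ChiSectionPairArchSectionShiftedU3` and whose archimedean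
non-vanishing at `3∕2` for EVERY odd coupling exponent `m_w` is file (γ).

THE MATHEMATICS ([BorelJacquet1979, §4.1]; [Rogawski1990, §1.9–§1.10]; [MoeglinWaldspurger1995, I.2.17, IV.1.11]).  At a complex place `w`, `K_w = U(V₊) × U(V₋) ≅ U(2) × U(1)` for the
`J₃`-eigenspaces `V₊ = ⟨e₀ + e₂, e₁⟩`, `V₋ = ⟨e₂ − e₀⟩` of the row space; a section of the induced representation is `F(x)·χ₂⟨det⟩` with `F` a function of the LAST ROW `x` on the isotropic
cone, and its `K_w`-types are `H^{p,q}(V₊) ⊗ (ℓ∕|ℓ|)^a` with `a + p − q = m_w` (the coupling exponent of the `(t_w, m_w)` table, ★ K2E1-p13 `lastRowChar_infiniteIdeles_midBlock`), each of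
multiplicity one.  The section of record ★ `archSectionE = Θ(ℓ)·χ₂⟨det⟩` is the type `p = q = 0`, `a = m_w`, whose archimedean factor at `3∕2` vanishes iff `|m_w| ≥ 3` (★ (a-10c)).  For odd
`m_w ≥ 1` the type `a = (m_w+1)∕2`, `p = (m_w−1)∕2`, `q = 0` (for `m_w ≤ −1` its conjugate `q = (|m_w|−1)∕2`, `p = 0`) has the NON-ZERO factor `(−1)^{p+1}π²∕((p+1)|β_w|)` (file (γ)), and
its highest vector is the RATIONAL TWIST of the section of record by `((x₀+x₂)∕(x₂−x₀))^p` — homogeneous of degree `0` in the last row, so left-Borel equivariance is untouched, and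
well defined on all of `G_∞` because `ℓ(a)_w ≠ 0` there (★ 3c-E `archLastRowL_fst_ne_zero`).  On the big cell (last row `(1, Ξ_w, Z_w)`) the twist is `((Z_w+1)∕(Z_w−1))^{p_w} = ((2+ζ_w)∕ζ_w)^{p_w}`.
* D1 `archLastRowS a := x₂ + x₀ ∈ 𝔸_L` (+ `archLastRowS_def`).
* D2 `archShiftFactor p q a : ℂ` — the twist, read in `ℂ` through the isometric embeddings `ι_w : L_w →+* ℂ` (+ `archShiftFactor_def`).
* D3 **`archSectionShifted χ₁ χ₂ p q a := archShiftFactor p q a · archSectionE χ₁ χ₂ a`** (+ `archSectionShifted_def`, `archSectionShifted_zero_zero`).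
HONEST LABEL: HC_CM is proved only modulo the 7 printed citations (2 remaining named inputs: hLiu418 = `stmt-HodgeConjecture-24832`, h413 = `stmt-HodgeConjecture-24833`) until
rung 0 closes; REL ≠ ★ ≠ BUILT; definitions pay nothing; (∞-2) is ★ only when files (β)(γ) land; count-neutral.

## References
* [BorelJacquet1979] A. Borel, H. Jacquet, *Automorphic forms and automorphic representations*, Corvallis PSPM 33.1 (1979), §4.1.
* [Rogawski1990] J. D. Rogawski, *Automorphic Representations of Unitary Groups in Three Variables* (1990), §1.9–§1.10.
* [MoeglinWaldspurger1995] C. Mœglin, J.-L. Waldspurger, *Spectral Decomposition and Eisenstein Series* (1995), I.2.17, IV.1.11.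
-/

set_option autoImplicit false
set_option linter.dupNamespace false  -- the mandated namespace `…HodgeConjecture.HodgeConjecture.R90.S8` repeats the summit's segment

noncomputable section

open NumberField ComplexConjugate
open Literature.NumberTheory.Automorphic Literature.NumberTheory.Automorphic.UnitaryGroup Literature.NumberTheory.GaloisRepresentations AdelicGroupData
open Literature.NumberTheory.Automorphic.Arthur2013.Leaves.TECR

namespace Summit.HodgeConjecture.HodgeConjecture.R90.S8

variable (L : Type) [Field L] [NumberField L] [IsCMField L]

/-! ## D1 The `V₊`-functional `𝓈(a) := x₂ + x₀` of the last row -/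

/-- **D1 — the last-row functional `𝓈(a) := (ι_∞ a)₂₂ + (ι_∞ a)₂₀ ∈ 𝔸_L`** (the `⟨e₀ + e₂⟩`-coordinate of the `J₃`-eigenspace `V₊`; companion of ★ `archLastRowL = x₂ − x₀`).  Like the whole
last row it scales by `b₂₂` under a left Borel translation. [cite: BorelJacquet1979, §4.1] [cite: Rogawski1990, §1.9] -/
def archLastRowS (a : arch (↥(maximalRealSubfield L)) L (IsCMField.complexConj L) 3 ((StdForm.antidiagonal 3).over L)) : AdeleRing (𝓞 L) L :=
  archLastRow L a 2 + archLastRow L a 0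

/-- Read-back (`rfl`). [cite: BorelJacquet1979, §4.1] -/
theorem archLastRowS_def (a : arch (↥(maximalRealSubfield L)) L (IsCMField.complexConj L) 3 ((StdForm.antidiagonal 3).over L)) :
    archLastRowS L a = archLastRow L a 2 + archLastRow L a 0 := rfl

/-! ## D2 The rational twist `∏_w ((x₀+x₂)_w ∕ ℓ_w)^{p_w} · (conj (x₀+x₂)_w ∕ conj ℓ_w)^{q_w}` -/

/-- **D2 — THE SHIFT FACTOR** `archShiftFactor p q a := ∏_{w ∣ ∞} (ι_w 𝓈(a)_w ∕ ι_w ℓ(a)_w)^{p_w} · (conj (ι_w 𝓈(a)_w) ∕ conj (ι_w ℓ(a)_w))^{q_w}` for exponents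
`p q : InfinitePlace L → ℕ` (of record: `p_w = (m_w − 1)∕2, q_w = 0` for `m_w ≥ 1`; `p_w = 0, q_w = (|m_w| − 1)∕2` for `m_w ≤ −1`), read in `ℂ` through the isometric embeddings
`ι_w : L_w →+* ℂ` (Mathlib `InfinitePlace.Completion.extensionEmbedding`).  Homogeneous of degree `0` in the last row (invariant under `x ↦ b₂₂·x`); `ℓ(a)_w ≠ 0` on `G_∞` (★ 3c-E), so no
junk value is ever met there; `= 1` at `a = 1` and `= ∏_w ((Z_w + 1)∕(Z_w − 1))^{p_w}·(conj…)^{q_w}` on the big cell. [cite: Rogawski1990, §1.10] [cite: BorelJacquet1979, §4.1] -/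
def archShiftFactor (p q : InfinitePlace L → ℕ) (a : arch (↥(maximalRealSubfield L)) L (IsCMField.complexConj L) 3 ((StdForm.antidiagonal 3).over L)) : ℂ :=
  ∏ w : InfinitePlace L,
    (InfinitePlace.Completion.extensionEmbedding w ((archLastRowS L a).1 w) / InfinitePlace.Completion.extensionEmbedding w ((archLastRowL L a).1 w)) ^ p w *
      (conj (InfinitePlace.Completion.extensionEmbedding w ((archLastRowS L a).1 w)) / conj (InfinitePlace.Completion.extensionEmbedding w ((archLastRowL L a).1 w))) ^ q w

/-- Read-back (`rfl`). [cite: Rogawski1990, §1.10] -/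
theorem archShiftFactor_def (p q : InfinitePlace L → ℕ) (a : arch (↥(maximalRealSubfield L)) L (IsCMField.complexConj L) 3 ((StdForm.antidiagonal 3).over L)) :
    archShiftFactor L p q a = ∏ w : InfinitePlace L,
      (InfinitePlace.Completion.extensionEmbedding w ((archLastRowS L a).1 w) / InfinitePlace.Completion.extensionEmbedding w ((archLastRowL L a).1 w)) ^ p w *
        (conj (InfinitePlace.Completion.extensionEmbedding w ((archLastRowS L a).1 w)) / conj (InfinitePlace.Completion.extensionEmbedding w ((archLastRowL L a).1 w))) ^ q w := rfl

/-- With no shift (`p = q = 0`) the factor is `1`. [folklore] -/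
theorem archShiftFactor_zero_zero (a : arch (↥(maximalRealSubfield L)) L (IsCMField.complexConj L) 3 ((StdForm.antidiagonal 3).over L)) :
    archShiftFactor L 0 0 a = 1 := by
  simp [archShiftFactor]

/-! ## D3 The shifted archimedean section -/

/-- **D3 — THE SHIFTED ARCHIMEDEAN SECTION `Φ^{p,q}(a) := archShiftFactor p q a · archSectionE χ₁ χ₂ a`** on `G_∞ = U(J₃)(L ⊗ ℝ)`: the highest vector of the `K_w`-type
`H^{p_w,q_w}(V₊) ⊗ (ℓ∕|ℓ|)^{m_w − p_w + q_w}` of the induced representation, place by place; left-`(χ₁,χ₂)`-equivariant with the SAME archimedean multiplier as ★ `archSectionE` (the twist has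
degree `0`), continuous, `Φ^{p,q}(1) = 1` (file (β)); for `p_w = (m_w−1)∕2` (`m_w` odd `≥ 1`; conjugate for `m_w ≤ −1`) its archimedean factor at `3∕2` is non-zero (file (γ)), which the
section of record (`p = q = 0`) achieves only for `|m_w| = 1`. [cite: Rogawski1990, §1.10] [cite: MoeglinWaldspurger1995, I.2.17, IV.1.11] [cite: BorelJacquet1979, §4.1] -/
def archSectionShifted (χ₁ : HeckeCharacter L) (χ₂ : ↥(TorusDict.torus (IsCMField.complexConj L)) →ₜ* ℂˣ) (p q : InfinitePlace L → ℕ)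
    (a : arch (↥(maximalRealSubfield L)) L (IsCMField.complexConj L) 3 ((StdForm.antidiagonal 3).over L)) : ℂ :=
  archShiftFactor L p q a * archSectionE L χ₁ χ₂ a

/-- Read-back (`rfl`). [cite: Rogawski1990, §1.10] -/
theorem archSectionShifted_def (χ₁ : HeckeCharacter L) (χ₂ : ↥(TorusDict.torus (IsCMField.complexConj L)) →ₜ* ℂˣ) (p q : InfinitePlace L → ℕ)
    (a : arch (↥(maximalRealSubfield L)) L (IsCMField.complexConj L) 3 ((StdForm.antidiagonal 3).over L)) :
    archSectionShifted L χ₁ χ₂ p q a = archShiftFactor L p q a * archSectionE L χ₁ χ₂ a := rfl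

/-- **No shift is the section of record**: `archSectionShifted χ₁ χ₂ 0 0 = archSectionE χ₁ χ₂`. [folklore] -/
theorem archSectionShifted_zero_zero (χ₁ : HeckeCharacter L) (χ₂ : ↥(TorusDict.torus (IsCMField.complexConj L)) →ₜ* ℂˣ) :
    archSectionShifted L χ₁ χ₂ 0 0 = archSectionE L χ₁ χ₂ := by
  funext a
  rw [archSectionShifted_def, archShiftFactor_zero_zero, one_mul]

end Summit.HodgeConjecture.HodgeConjecture.R90.S8

end
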